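/-
Copyright (c) 2026. All rights reserved.
Released under Apache 2.0 license as described in the file LICENSE.
Authors: abc-iut cell, prover seat abc-iut-L4-d2 (gen 6).
-/
import Literature.AnabelianGeometry.AbsoluteAnabelian.GaloisTheatersNumberFieldShadowAut
import Literature.AnabelianGeometry.AbsoluteAnabelian.PanalocalTheatersMapsHom
import HarnessLib

/-!
# [AbsTopIII] Def 5.1 (iv) / Cor 5.2 (v), morphism part (F-0183) PROVED at the number-field shadow context

S. Mochizuki, *Topics in absolute anabelian geometry III* [MochizukiAbsTopIII2015], Def 5.1 (iv) p. 116 ("we obtain a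
natural panalocalization functor `Th⊚ → Th✠`") / Cor 5.2 (v) p. 120.  The cell's named fact `PanalocalizationMapsHom R`
(F-0183, `PanalocalTheaters.lean`; universal closure refuted) was reduced by abc-iut-f-104
(`panalocalizationMapsHom_of_mapProVal_descends`, `PanalocalTheatersMapsHom.lean`) to: (H1) `V⊚(f)` respects
`⊚ / V^non / V^arc`; (H2) `V⊚(f)` DESCENDS to a bijection `V⊚(Π₁)/Aut(Π₁) ≅ V⊚(Π₂)/Aut(Π₂)`; (H3) `X(Π₁, ṽ) ≅ X(Π₂, V⊚(f)ṽ)`.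

THIS PROOF-ONLY FILE discharges (H1)–(H3) AT `R := NumberFieldShadow.context F` (abc-iut-L4-d2 g6).  The substance is
(H2): through the injective `ℚ`-chart of an admissible `Π_E` with range `U_E ⊆ Γ = G_ℚ`
(`GaloisTheatersNumberFieldShadowAut.lean`), `Aut(Π_E)` acts on `V⊚(Π_E) = V⊚(ℚ̄/ℚ)` exactly through the NORMALISER
`N_Γ(U_E)` (`autRel_iff_exists_mem_normalizer`: every automorphism gives a normalising conjugator, and every normalising
element is a conjugator), so `V⊚(Π_E)/Aut(Π_E) = V⊚(ℚ̄/ℚ)/N_Γ(U_E)` (print's `V⊚(F_mod)`); and a morphism `f` of `EA⊚`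
between admissible objects satisfies `τ_f U₁ τ_f⁻¹ = U₂`, hence `τ_f N_Γ(U₁) τ_f⁻¹ = N_Γ(U₂)`, so translation by `τ_f`
descends to a BIJECTION of the quotients (`exists_modAut_equiv`).  (H3) is the geometric isomorphism `Δ₁ ≅ Δ₂` of
`IsBaseChange` (`nonempty_geomEquiv_of_isEAHom`; the archimedean orbispaces are stubs).  Result:
**`panalocalizationMapsHom_context : PanalocalizationMapsHom (context F)`**.

HONEST LABEL: «instance PROVED at the number-field SHADOW context» (`Δ = 1`, stub archimedean geometry) — NOT at print's
`EA⊚` of hyperbolic orbicurves (E-L4-13).  Classical; nothing here bears on [IUTchIII] Cor. 3.12 or takes a side.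
-/

noncomputable section

open scoped Pointwise Topology
open CategoryTheory NumberField Field

namespace Literature.AnabelianGeometry.AbsoluteAnabelian

namespace NumberFieldShadow

variable (F : Type) [Field F] [NumberField F]

/-! ### Normalisers and conjugation of subgroups -/

/-- `σ U σ⁻¹ = U` iff `σ` lies in the normaliser of `U`. [cite: MochizukiAbsTopIII2015, Def 5.1 (ii) p.115] -/
theorem map_conj_eq_self_iff_mem_normalizer {G : Type} [Group G] (U : Subgroup G) (σ : G) :
    U.map (MulAut.conj σ).toMonoidHom = U ↔ σ ∈ Subgroup.normalizer (U : Set G) := by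
  rw [Subgroup.mem_normalizer_iff]
  constructor
  · intro h x
    constructor
    · intro hx
      rw [← h]
      exact ⟨x, hx, rfl⟩
    · intro hx
      rw [← h] at hx
      obtain ⟨u, hu, hux⟩ := hx
      have : u = x := by
        have hux' : σ * u * σ⁻¹ = σ * x * σ⁻¹ := hux
        simpa using hux'
      exact this ▸ hu
  · intro h
    ext x
    constructor
    · rintro ⟨u, hu, rfl⟩
      exact (h u).mp hu
    · intro hx
      refine ⟨σ⁻¹ * x * σ⁻¹⁻¹, (h _).mpr ?_, ?_⟩
      · have : σ * (σ⁻¹ * x * σ⁻¹⁻¹) * σ⁻¹ = x := by group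
        rw [this]; exact hx
      · change σ * (σ⁻¹ * x * σ⁻¹⁻¹) * σ⁻¹ = x
        group

/-- If `τ U₁ τ⁻¹ = U₂` then `x ∈ U₂ ↔ τ⁻¹ x τ ∈ U₁`. [cite: MochizukiAbsTopIII2015, Def 5.1 (iii) p.115] -/
theorem mem_iff_of_map_conj_eq {G : Type} [Group G] {U₁ U₂ : Subgroup G} {τ : G}
    (h : U₁.map (MulAut.conj τ).toMonoidHom = U₂) (x : G) : x ∈ U₂ ↔ τ⁻¹ * x * τ ∈ U₁ := by
  rw [← h]
  constructor
  · rintro ⟨u, hu, rfl⟩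
    have : τ⁻¹ * (τ * u * τ⁻¹) * τ = u := by group
    change τ⁻¹ * (τ * u * τ⁻¹) * τ ∈ U₁
    rw [this]; exact hu
  · intro hx
    refine ⟨τ⁻¹ * x * τ, hx, ?_⟩
    change τ * (τ⁻¹ * x * τ) * τ⁻¹ = x
    group

/-- If `τ U₁ τ⁻¹ = U₂` then `τ N(U₁) τ⁻¹ ⊆ N(U₂)`. [cite: MochizukiAbsTopIII2015, Def 5.1 (iii) p.115] -/
theorem conj_mem_normalizer_of_map_conj_eq {G : Type} [Group G] {U₁ U₂ : Subgroup G} {τ : G}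
    (h : U₁.map (MulAut.conj τ).toMonoidHom = U₂) {σ : G} (hσ : σ ∈ Subgroup.normalizer (U₁ : Set G)) :
    τ * σ * τ⁻¹ ∈ Subgroup.normalizer (U₂ : Set G) := by
  rw [Subgroup.mem_normalizer_iff] at hσ ⊢
  intro x
  rw [mem_iff_of_map_conj_eq h, mem_iff_of_map_conj_eq h, hσ (τ⁻¹ * x * τ)]
  have : σ * (τ⁻¹ * x * τ) * σ⁻¹ = τ⁻¹ * (τ * σ * τ⁻¹ * x * (τ * σ * τ⁻¹)⁻¹) * τ := by group
  rw [this]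

/-- If `τ U₁ τ⁻¹ = U₂` then `τ⁻¹ N(U₂) τ ⊆ N(U₁)`. [cite: MochizukiAbsTopIII2015, Def 5.1 (iii) p.115] -/
theorem inv_conj_mem_normalizer_of_map_conj_eq {G : Type} [Group G] {U₁ U₂ : Subgroup G} {τ : G}
    (h : U₁.map (MulAut.conj τ).toMonoidHom = U₂) {σ : G} (hσ : σ ∈ Subgroup.normalizer (U₂ : Set G)) :
    τ⁻¹ * σ * τ ∈ Subgroup.normalizer (U₁ : Set G) := by
  have h' : U₂.map (MulAut.conj τ⁻¹).toMonoidHom = U₁ := by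
    rw [← h, Subgroup.map_map]
    conv_rhs => rw [← Subgroup.map_id U₁]
    congr 1
    ext x
    change τ⁻¹ * (τ * x * τ⁻¹) * τ⁻¹⁻¹ = x
    group
  have := conj_mem_normalizer_of_map_conj_eq h' hσ
  simpa using this

/-! ### `Aut(Π_E)` acts on `V⊚(Π_E)` through the normaliser of the chart range -/

/-- **`V⊚(Π_E)/Aut(Π_E) = V⊚(ℚ̄/ℚ)/N_Γ(U_E)`**: for admissible `E`, `w = Aut(Π_E) · v` iff `w = σ · v` for some `σ` in the
normaliser of the chart range `U_E` (the conjugator of an automorphism normalises `U_E`; every normalising element is a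
conjugator). [cite: MochizukiAbsTopIII2015, Def 5.1 (ii) p.115] -/
theorem autRel_iff_exists_mem_normalizer {E : FundamentalExtension.{0}} (hE : IsAdmissible F E)
    (v w : ((context F).proVal E).carrier) :
    (context F).AutRel E v w ↔ ∃ σ ∈ Subgroup.normalizer (((ratChart E).toMonoidHom.range : Subgroup (absoluteGaloisGroup ℚ)) :
      Set (absoluteGaloisGroup ℚ)),
      (letI := (NumberField.valuationProSet ℚ).action;
        σ • (show (NumberField.valuationProSet ℚ).carrier from v) = w) := by
  letI := (NumberField.valuationProSet ℚ).action
  constructor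
  · rintro ⟨α, hα, h⟩
    exact ⟨conjugator α.hom hα, (map_conj_eq_self_iff_mem_normalizer _ _).mp
      (map_conj_conjugator_range_eq_self F hE α hα), h⟩
  · rintro ⟨σ, hσ, h⟩
    obtain ⟨α, hα, hc⟩ := exists_iso_of_map_conj_range_eq F hE σ
      ((map_conj_eq_self_iff_mem_normalizer _ _).mpr hσ)
    refine ⟨α, hα, ?_⟩
    change conjugator α.hom hα • (show (NumberField.valuationProSet ℚ).carrier from v) = w
    rw [hc]
    exact h

/-- The equivalence relation generated by `Aut(Π_E) · (−)` is again the normaliser-orbit relation (the normaliser is a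
subgroup). [cite: MochizukiAbsTopIII2015, Def 5.1 (ii) p.115] -/
theorem exists_mem_normalizer_of_eqvGen_autRel {E : FundamentalExtension.{0}} (hE : IsAdmissible F E)
    {v w : ((context F).proVal E).carrier} (h : Relation.EqvGen ((context F).AutRel E) v w) :
    ∃ σ ∈ Subgroup.normalizer (((ratChart E).toMonoidHom.range : Subgroup (absoluteGaloisGroup ℚ)) :
      Set (absoluteGaloisGroup ℚ)),
      (letI := (NumberField.valuationProSet ℚ).action;
        σ • (show (NumberField.valuationProSet ℚ).carrier from v) = w) := by
  letI := (NumberField.valuationProSet ℚ).action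
  induction h with
  | rel x y hxy => exact (autRel_iff_exists_mem_normalizer F hE x y).mp hxy
  | refl x => exact ⟨1, Subgroup.one_mem _, one_smul _ _⟩
  | symm x y _ ih =>
      obtain ⟨σ, hσ, h⟩ := ih
      refine ⟨σ⁻¹, Subgroup.inv_mem _ hσ, ?_⟩
      change σ⁻¹ • (show (NumberField.valuationProSet ℚ).carrier from y) = x
      rw [← h, inv_smul_smul]
  | trans x y z _ _ ih₁ ih₂ =>
      obtain ⟨σ, hσ, h⟩ := ih₁
      obtain ⟨σ', hσ', h'⟩ := ih₂
      refine ⟨σ' * σ, Subgroup.mul_mem _ hσ' hσ, ?_⟩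
      change (σ' * σ) • (show (NumberField.valuationProSet ℚ).carrier from x) = z
      rw [mul_smul, h, h']

/-! ### (H2): `V⊚(f)` descends to a bijection of the `Aut`-quotients -/

/-- **(H2) at the shadow context**: for a morphism `f` of `EA⊚` between admissible objects, translation by the
conjugator `τ_f` DESCENDS to a bijection `V⊚(Π₁)/Aut(Π₁) ≅ V⊚(Π₂)/Aut(Π₂)` (because `τ_f N_Γ(U₁) τ_f⁻¹ = N_Γ(U₂)`).
[cite: MochizukiAbsTopIII2015, Def 5.1 (iv) p.116] -/
theorem exists_modAut_equiv {E₁ E₂ : FundamentalExtension.{0}} (h₁ : IsAdmissible F E₁) (h₂ : IsAdmissible F E₂)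
    (f : E₁ ⟶ E₂) (hf : IsEAHom f) :
    ∃ β : (context F).ProValModAut E₁ ≃ (context F).ProValModAut E₂,
      ∀ v, β ((context F).toModAut E₁ v) = (context F).toModAut E₂ ((context F).mapProVal f hf v) := by
  letI := (NumberField.valuationProSet ℚ).action
  have hU := map_conj_conjugator_range_eq F h₁ h₂ f hf
  -- `V⊚(f) = τ_f • −` on the common carrier `V⊚(ℚ̄/ℚ)`
  have hmap : ∀ v : (NumberField.valuationProSet ℚ).carrier,
      (context F).mapProVal f hf v = conjugator f hf • v := fun _ => rfl
  -- the map on quotients is well defined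
  let βf : (context F).ProValModAut E₁ → (context F).ProValModAut E₂ :=
    Quot.lift (fun v => (context F).toModAut E₂ ((context F).mapProVal f hf v)) (by
      intro v v' hvv'
      obtain ⟨σ, hσ, hσv⟩ := (autRel_iff_exists_mem_normalizer F h₁ v v').mp hvv'
      apply Quot.sound
      refine (autRel_iff_exists_mem_normalizer F h₂ _ _).mpr
        ⟨conjugator f hf * σ * (conjugator f hf)⁻¹, conj_mem_normalizer_of_map_conj_eq hU hσ, ?_⟩
      change (conjugator f hf * σ * (conjugator f hf)⁻¹) •
          (show (NumberField.valuationProSet ℚ).carrier from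
            (context F).mapProVal f hf (show (NumberField.valuationProSet ℚ).carrier from v)) =
        (show (NumberField.valuationProSet ℚ).carrier from
          (context F).mapProVal f hf (show (NumberField.valuationProSet ℚ).carrier from v'))
      rw [hmap, hmap, ← hσv, mul_smul, mul_smul, inv_smul_smul])
  refine ⟨Equiv.ofBijective βf ⟨?_, ?_⟩, fun v => rfl⟩
  · -- injective
    intro q q' hqq'
    induction q using Quot.ind with | _ v => ?_
    induction q' using Quot.ind with | _ v' => ?_
    change (context F).toModAut E₂ ((context F).mapProVal f hf v) =
      (context F).toModAut E₂ ((context F).mapProVal f hf v') at hqq'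
    obtain ⟨σ₂, hσ₂, hσ₂v⟩ := exists_mem_normalizer_of_eqvGen_autRel F h₂ (Quot.eqvGen_exact hqq')
    apply Quot.sound
    refine (autRel_iff_exists_mem_normalizer F h₁ v v').mpr
      ⟨(conjugator f hf)⁻¹ * σ₂ * conjugator f hf, inv_conj_mem_normalizer_of_map_conj_eq hU hσ₂, ?_⟩
    have h' : conjugator f hf • (show (NumberField.valuationProSet ℚ).carrier from v') =
        σ₂ • conjugator f hf • (show (NumberField.valuationProSet ℚ).carrier from v) := by
      rw [← hmap, ← hmap]; exact hσ₂v.symm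
    change ((conjugator f hf)⁻¹ * σ₂ * conjugator f hf) • (show (NumberField.valuationProSet ℚ).carrier from v) =
      (show (NumberField.valuationProSet ℚ).carrier from v')
    rw [mul_smul, mul_smul, ← h', inv_smul_smul]
  · -- surjective
    intro q
    induction q using Quot.ind with | _ w => ?_
    refine ⟨(context F).toModAut E₁
      (show ((context F).proVal E₁).carrier from
        (conjugator f hf)⁻¹ • (show (NumberField.valuationProSet ℚ).carrier from w)), ?_⟩
    change (context F).toModAut E₂ ((context F).mapProVal f hf _) = (context F).toModAut E₂ w
    rw [hmap, smul_inv_smul]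

/-! ### (H3): the geometric isomorphism `Δ₁ ≅ Δ₂` -/

/-- A morphism `f` of `EA⊚` restricts to a topological isomorphism `Δ₁ ≅ Δ₂` (`IsBaseChange`: `f` is a continuous
bijection `Δ₁ → Δ₂` of compact Hausdorff groups). [cite: MochizukiAbsTopIII2015, Def 5.1 (iii) p.115] -/
theorem nonempty_geomEquiv_of_isEAHom {E₁ E₂ : FundamentalExtension.{0}} (f : E₁ ⟶ E₂) (hf : IsEAHom f) :
    ∃ e : E₁.geom ≃ₜ* E₂.geom, ∀ a : E₁.geom, ((e a : E₂.geom) : E₂.arith) = f.arith a := by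
  have hbij := hf.bijOn_geom
  let r : E₁.geom →* E₂.geom :=
    (f.arith.toMonoidHom.restrict E₁.geom).codRestrict E₂.geom fun a => hbij.mapsTo a.2
  have hrbij : Function.Bijective r := by
    refine ⟨fun a b h => Subtype.ext (hbij.injOn a.2 b.2 (congrArg Subtype.val h)), fun b => ?_⟩
    obtain ⟨a, ha, hab⟩ := hbij.surjOn b.2
    exact ⟨⟨a, ha⟩, Subtype.ext hab⟩
  haveI : CompactSpace E₁.geom := isCompact_iff_compactSpace.mp E₁.isClosed_geom.isCompact
  let e₀ : E₁.geom ≃* E₂.geom := MulEquiv.ofBijective r hrbij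
  have hc : Continuous e₀ := (f.arith.continuous.comp continuous_subtype_val).subtype_mk _
  exact ⟨{ e₀ with
      continuous_toFun := hc
      continuous_invFun := Continuous.continuous_symm_of_equiv_compact_to_t2 (f := e₀.toEquiv) hc },
    fun _ => rfl⟩

/-! ### F-0183 at the shadow context -/

/-- **Def 5.1 (iv) / Cor 5.2 (v), morphism part (F-0183), PROVED at the number-field shadow context**: every morphism of
`EA⊚` between (admissible) global Galois groups induces a morphism between ANY panalocalizations of their canonical
theaters. [cite: MochizukiAbsTopIII2015, Def 5.1 (iv) p.116] -/
theorem panalocalizationMapsHom_context : PanalocalizationMapsHom (context F) :=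
  panalocalizationMapsHom_of_mapProVal_descends (context F)
    (fun f hf _ _ => contextMapProVal_generic f hf)
    (fun f hf _ _ v hv => contextMapProVal_mem_non f hf v hv)
    (fun f hf _ _ v hv => contextMapProVal_mem_arc f hf v hv)
    (fun f hf h₁ h₂ => exists_modAut_equiv F h₁ h₂ f hf)
    (fun f hf _ _ _ => by
      obtain ⟨e, -⟩ := nonempty_geomEquiv_of_isEAHom f hf
      exact ⟨⟨Homeomorph.refl _, RingEquiv.refl _, e⟩⟩)

end NumberFieldShadow

end Literature.AnabelianGeometry.AbsoluteAnabelian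

end
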